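import Mathlib
import HarnessLib
import HarnessLib.Audit
import Summits.AtomisticToContinuum.Statement
import Summits.AtomisticToContinuum.BoseEinsteinCondensation.Theorems.BECCutLineWeakDisorderOccupationStability
import HarnessLib.Audit.Status.Attr

/-!
Route: BECHeatBathGap

# Route BECHeatBathGap — condensate deficit ≤ heat-bath gap⁻¹ of |Ψ_N|² × one-particle influence
sum, mode-free Dirichlet frame, decided

It suffices to show X = ParticleTensorisation ∧ SquareSummableInfluence (card
glauber-tensorisation-depletion, items A1 ∧ A2), in the
MODE-FREE DIRICHLET frame of the retired gen-1 route BECHeatBathTensorisation (retired only as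
`not-a-thesis`: its assembly named the
Literature decl; this route carries the deciding theorem `closes … : BoseEinsteinCondensation`). For
a unit N-body state Θ and an
(N+1)-body state Ψ in one box put m(y) = ⟨Θ, Ψ(y,·)⟩. Exactly: λ_max(γ_Ψ) ≥ (N+1)‖m‖²
(DirichletRemovalBound) and
1 − ‖m‖² = ∫dy min_c ‖Ψ(y,·) − cΘ‖² ≤ C_AT(Θ) · I(Θ,Ψ), where C_AT(Θ) is the
approximate-tensorisation (AT) constant of the Born
law |Θ|² over PARTICLE LABELS — the inverse spectral gap of the heat-bath Gibbs sampler that deletes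
one particle and re-inserts it from
its conditional law — and I(Θ,Ψ) = Σ_i inf_g ‖Ψ − g_i(y, X∖x_i)·Θ‖² is the total squared influence
of single bath particles on the
insertion amplitude Ψ/Θ. A1 (ParticleTensorisation): C_AT = O(1) uniformly in N and ρ < ρ₀ for a
near-minimiser witnessing the N-body
Dirichlet ground state at every slack. A2 (SquareSummableInfluence): I = o(1) as ρ → 0, uniformly in
N. Then SOME near-minimiser has
λ_max ≥ ¾(N+1) at every slack (TensorisedIncrement), and fixed-N phase rigidity
(GroundStateRigidity, shared) makes it ⅜(N+1) for EVERY
near-minimiser at some slack (NearMinimiserStability, WitnessToBEC): HasGroundStateBEC v ρ for ρ <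
ρ₀(v), i.e. the sub-problem Statement.
Lean: `ParticleTensorisation ∧ SquareSummableInfluence`

## Assembly
Pure logic (Sketch.lean rc 0, axioms propext / Classical.choice / Quot.sound): TensorisedIncrement
turns A1, A2 and the removal bound into
SomeNearMinimiserCondenses; WitnessToBEC feeds it through NearMinimiserStability (from
GroundStateRigidity at index N+1) and
le_condensateNumber to HasGroundStateBEC v ρ with c = 3/8 for every ρ < ρ₀, i.e. the conjunct.
Deciding theorem (glue.lean):
`theorem closes (h1 : ParticleTensorisation) (h2 : SquareSummableInfluence) (h3 :
GroundStateRigidity) (h4 : DirichletRemovalBound)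
(h5 : TensorisedIncrement) (h6 : NearMinimiserStability) (h7 : WitnessToBEC) :
BoseEinsteinCondensation := h7 (h5 h1 h2 h4) h6 h3`.

Rationale: WHY THIS LINE. The positivity/landscape lines on this conjunct (retired BECPalmLandscape,
BECSwapAffinity, BECConditionalEntropy; open BECLiebAntibunching,
BECRieszShadow) must bound the VARIANCE OF A CORRELATED SUM — the insertion cost Σ_j u_eff(y − x_j)
— finite only through hyperuniform
cancellations (S(k) ≲ kξ) of the true ground state, and BECRecoilCorrector bounded the same
insertion amplitude by Kipnis–Varadhan
correctors of the ground-state DIFFUSION, whose gap closes like c/L. Here the Efron–Stein /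
approximate-tensorisation inequality
Var ≤ C_AT Σ_i E Var_i (EfronStein1981, CaputoMenzTetali2016; the "spectral-gap method" of
stochastic homogenisation GloriaOtto2011,
GloriaNeukammOtto2014; heat-bath and Glauber gaps for CONTINUUM Gibbs measures Bertini2002, Wu2004,
Wu2006, KondratievKunaOhlerich2013,
MichelenPerkins2022, HelmuthPerkinsPetti2022, arXiv:2601.18748, arXiv:2606.28009) is imported from
Markov-chain mixing / functional
inequalities and applied to |Θ_N|² over particle labels: the cross terms disappear by construction
(I has no pair correlation and no
structure factor), and the entire many-body content sits in ONE number, the relaxation time of a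
FICTITIOUS sampler that relocates a
particle across the whole box in a single move and is therefore blind to the kinetic gap π²/L². The
physics precedent for reading BEC off
the conditional one-particle amplitude is Mayers2001 (n₀/N = E_s|⟨φ₀,ψ_s⟩|², heuristic); the
increment step is Reatto1969 / PenroseOnsager1956
for Jastrow states. What this route adds to the card and to gen 1: the deciding theorem; the
mode-free removal bound (no torus, no
translation invariance, no BoundaryTransferWeak — the audit's circularity y-term vanishes
identically); needle-proof typing (existential
AT witness — the universal form is false by locally dominant microscopic bumps —, L²-continuous
universal form for A2, rigidity shared
with stmt-9072); two provable rungs that de-risk the typing (JastrowDobrushinRung under Dobrushin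
uniqueness, IdealGasTensorisation at v = 0).
No refuted statement of the negatives index is restated (the only BEC negative, SwapJensen
stmt-3980, was a sign exploit in another engine).

RANKED CRUXES. #2 ParticleTensorisation (crux) — (card A1, Dirichlet, division-free) for every
repulsive finite-range v there are ρ₀ > 0 and C such that for 0 < ρ < ρ₀ and all large N, at EVERY
slack δ > 0 SOME δ-near-minimiser Θ of the Dirichlet N-body energy in the box of side
((N+1)/ρ)^(1/3) satisfies approximate tensorisation of variance over particle labels with constant
C: for all bounded measurable F : Λ^N → ℂ and bounded measurable predictors g_i not depending on
x_i, min_c ∫ |F − cΘ|² ≤ C Σ_i ∫ |F − g_i Θ|² (for Θ > 0 a.e. this is Var_Θ²(f) ≤ C Σ_i E Var(f |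
x_j, j ≠ i), f = F/Θ: heat-bath spectral gap ≥ 1/C); existential in Θ because near-minimisers at
fixed δ may carry locally dominant microscopic bumps that trap the sampler. [difficulty:
open-problem] (why it might fail: Uncharted: C uniform in L though the one-particle TV influence is
ℓ¹-divergent (r⁻² phonon tail, Dobrushin row sums ~L/ξ): Wu/Dobrushin fail, Holley–Stroock useless
(extensive log-density errors), Bauerschmidt–Bodineau needs Gibbs structure; one slow nonlinear
collective mode kills it.) [Bertini2002, Wu2006, Wu2004, BauerschmidtBodineau2019,
CaputoMenzTetali2016, KondratievKunaOhlerich2013, MichelenPerkins2022, HelmuthPerkinsPetti2022,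
GloriaNeukammOtto2014, EfronStein1981, arXiv:2606.28009]
#3 SquareSummableInfluence (crux) — (card A2, Dirichlet) for every repulsive finite-range v and
every ε > 0 there is ρ₀ > 0 such that for 0 < ρ < ρ₀ and all large N there is δ₂ > 0 with: for EVERY
δ₂-near-minimiser Θ of the N-body Dirichlet energy in the box of side ((N+1)/ρ)^(1/3) and every δ >
0, SOME δ-near-minimiser Ψ of the (N+1)-body energy in the same box admits bounded measurable
predictors g_i(y, X without x_i) with Σ_i ∫ |Ψ(y,X) − g_i(y,X)Θ(X)|² ≤ ε — the total squared
single-bath-particle resampling influence on the insertion amplitude is o(1) (heuristically ≈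
5√(ρa³): core + a/r part up to ξ + Reatto–Chester r⁻² tail, each square-integrable in d = 3;
universal in Θ is safe because I is L²-continuous in Θ, given rigidity at level N, δ₂ being chosen
after N). [difficulty: XL] (why it might fail: Needs the DRESSED decay of the y–x_i correlation in
Ψ_(N+1)/Θ_N: with the undressed a/r tail out to L the sum is ~ρa²L → ∞; square-summability is the
Reatto–Chester r⁻² law for the TRUE ground state, where the T = 0 infrared lives; universal-in-Θ
typing presupposes fixed-N rigidity.) [ReattoChester1967, Reatto1969, Mayers2001,
PenroseOnsager1956, LiebSeiringerSolovejYngvason2005,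
Literature.Barriers.AtomisticToContinuum.BogoliubovPerturbationInfraredNarrow]
#4 GroundStateRigidity (crux) — (shared verbatim with stmt-AtomisticToContinuum-9072 / 3298) L²
phase rigidity of Dirichlet near-minimisers at fixed N: for every repulsive finite-range v there is
ρ₀ > 0 such that for 0 < ρ < ρ₀ and all large N, for every η > 0 there is δ > 0 with: any two
δ-near-minimisers Ψ, Φ ∈ TrialState N L (L = (N/ρ)^(1/3)) satisfy ∫|Ψ − cΦ|² ≤ η for some unit c ∈
ℂ; used at index N+1 to pass from the good witness to all near-minimisers (NearMinimiserStability)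
and, implicitly, at index N inside A2. [difficulty: M] (why it might fail: Hard cores (v = ⊤ on
[0,R₀]) are admissible: the hard-sphere configuration space in Λ_L can be disconnected (caged/jammed
components), so uniqueness needs every non-dilute component to sit a fixed-N gap above E₀ — a
quantitative bound not in print.) [ReedSimonIV1978, Simon1982, BaryshnikovBubenikKahle2013,
Kahle2012, LiebSeiringerSolovejYngvason2005]
#9 OccupationStability (support) — (shared verbatim with stmt-AtomisticToContinuum-9074 / 3300; the
√N-Lipschitz lemma behind NearMinimiserStability) for a normalised measurable mode u, trial states
Ψ, Φ ∈ TrialState (n+1) L and |c| = 1: occ(u,Ψ)^(1/2) ≤ occ(u,Φ)^(1/2) + (n+1)^(1/2)·‖Ψ − cΦ‖₂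
(Cauchy–Schwarz in the first variable, Minkowski in L²(dY), occ(cΦ) = occ(Φ)). [difficulty:
provable-now] [LiebSeiringerSolovejYngvason2005]
#9 DirichletRemovalBound (support) — (verbatim the mooted shared item
stmt-AtomisticToContinuum-4389) mode-free removal bound in ANY box — the operator inequality γ_Φ ≥
(N+1)|g⟩⟨g|, g(y) = ∫ conj Θ(X) Φ(y,X) dX for every normalised N-body Θ: (N+1)∫|g(y)|² dy ≤
maxOccupation (N+1) Φ for Dirichlet trial states Φ (N+1 bodies) and Θ (N bodies); proof: if g ≠ 0
test maxOccupation with φ = g/‖g‖ and apply Cauchy–Schwarz against Θ in the remaining variables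
(‖g‖⁴ = |⟨K*g, conj Θ⟩|² ≤ ‖K*g‖²). [difficulty: M] [PenroseOnsager1956,
LiebSeiringerSolovejYngvason2005]
#9 SomeNearMinimiserCondenses (support) — (intermediate node: the route's λ_max statement before
rigidity) for every repulsive finite-range v there is ρ₀ > 0 such that for 0 < ρ < ρ₀ there is c > 0
with: for all large N and every δ > 0 SOME δ-near-minimiser Ψ of the (N+1)-body Dirichlet energy in
the box of side ((N+1)/ρ)^(1/3) has λ_max(γ_Ψ) = maxOccupation ≥ c(N+1). It is the conclusion of
TensorisedIncrement (c = 3/4) and the first hypothesis of WitnessToBEC; filed before both so that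
the rendered file has no forward reference. [difficulty: open-problem] [PenroseOnsager1956,
LiebSeiringerSolovejYngvason2005]
#9 TensorisedIncrement (support) — (card A3, the glue of the engine) ParticleTensorisation →
SquareSummableInfluence → DirichletRemovalBound → SomeNearMinimiserCondenses. Proof: with C from A1
take ε = 1/(4C) in A2; ρ₀ = min of the two thresholds, c = 3/4; for large N take δ₂ (A2), the
witness Θ* of A1 at slack δ₂, and for each δ the witness Ψ_δ of A2 applied to Θ*; apply A1 fibrewise
in y to F_y = Ψ_δ(y,·), g_(y,i) = g_i(y,·) (bounded, measurable, update-invariant via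
Fin.cons_update), compare with the projection onto the unit vector Θ*: ∫|F_y|² ≤ |m(y)|² + C Σ_i
∫|F_y − g_(y,i)Θ*|² (no truncated subtraction), integrate over y (Tonelli; vecCons is a
measure-preserving equivalence Λ × Λ^N ≃ Λ^(N+1)): 1 ≤ ∫|m|² + Cε = ∫|m|² + 1/4;
DirichletRemovalBound then gives maxOccupation (N+1) Ψ_δ ≥ (N+1)∫|m|² ≥ (3/4)(N+1). Lean-heavy
(MeasurableEquiv for vecCons, lintegral ↔ Bochner, Cauchy–Schwarz), mathematically routine.
[difficulty: L] [EfronStein1981, PenroseOnsager1956]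
#9 NearMinimiserStability (support) — (verbatim the mooted shared item
stmt-AtomisticToContinuum-3984) GroundStateRigidity → for every v, small ρ and all large N: if for
every δ > 0 SOME δ-near-minimiser has maxOccupation ≥ m, then for some δ > 0 EVERY δ-near-minimiser
has maxOccupation ≥ m/2. Proof from rigidity with η ~ (1 − 1/√2)² m/N and OccupationStability taken
sup over modes (maxOccupation^(1/2) is √N-Lipschitz in L² up to phase); m ≤ N is forced by the
hypothesis (maxOccupation ≤ N by Cauchy–Schwarz), m = ⊤ and empty TrialState make it vacuous.
[difficulty: provable-now] [LiebSeiringerSolovejYngvason2005]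
#9 WitnessToBEC (support) — (frame; NEW w.r.t. gen 1: concludes the sub-problem Statement decl
`BoseEinsteinCondensation`, the root abbrev, by name) SomeNearMinimiserCondenses →
NearMinimiserStability → GroundStateRigidity → BoseEinsteinCondensation: for v repulsive
finite-range take ρ₀ = min of the thresholds; eventually in N instantiate stability at index N+1
with m = ofReal(c(N+1)) to get δ > 0 with maxOccupation ≥ m/2 for every δ-near-minimiser, then
le_condensateNumber and the index shift ∀ᶠ N ↦ N+1 (Nat.cast_succ, eventually_atTop) give
HasGroundStateBEC v ρ with constant c/2. [difficulty: provable-now]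
[LiebSeiringerSolovejYngvason2005, PenroseOnsager1956]
#9 JastrowDobrushinRung (support) — (card A4, classical rung; a theorem-candidate that de-risks the
engine and its division-free typing) for 0 ≤ f ≤ 1 even measurable with 1 − f² integrable and 5N∫(1
− f²) ≤ L³ (L > 0), the Jastrow law ∝ ∏_(i<j) f(x_i − x_j)² dX on Λ_L^N satisfies approximate
tensorisation over particles with constant 2: min_c ∫|F − c|²P ≤ 2 Σ_i ∫|F − g_i|²P (heat-bath gap ≥
1/2). Proof sketch: the TV-Dobrushin influence of x_j on the conditional law of x_i is ≤
2∫(1−f²)/((1−α)L³), α = N∫(1−f²)/L³ ≤ 1/5 (Z ≥ L³(1−α) by ∏(1−ε_k) ≥ 1 − Σε_k), so row sums r ≤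
2α/(1−α) ≤ 1/2; the Gibbs-sampler Dirichlet form is Σ_i E Var_i and its gap is ≥ 1 − r under
Dobrushin uniqueness (Wu2006; DobrushinShlosman1985). By the route's inequality it re-proves BEC for
Reatto's Jastrow states without cluster expansions. N = 0, 1 and f ≡ 1 (Efron–Stein) are the trivial
corners, all true. [difficulty: M] [Wu2006, DobrushinShlosman1985, HoudebertZass2022, Reatto1969,
Bertini2002, EfronStein1981]
#9 IdealGasTensorisation (support) — (NEW ideal-gas rung = the body of ParticleTensorisation at v =
0, all densities: a typing check of the existential-witness AT clause that a prover can settle now)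
there is C > 0 (C = 1 works) such that for every ρ > 0, all large N and every δ > 0 some
δ-near-minimiser Θ of the FREE N-body Dirichlet energy in the box of side ((N+1)/ρ)^(1/3) satisfies
the AT clause of A1 with constant C. Proof: Θ = φ^⊗N with φ a C¹ one-body state supported in the
open box and ∫|∇φ|² ≤ e₁ + δ/N, e₁ the one-body infimum; E₀(N) ≥ N·e₁ by applying the one-body
Rayleigh bound slice-wise (homogeneity + Fubini; the value 3π²/L² is not needed), so Θ is a
δ-near-minimiser; AT with C = 1 is Efron–Stein for the product law |φ|^(2⊗N) in the division-free
form (on Θ = 0 both sides carry ∫|F|², N ≥ 1). [difficulty: M] [EfronStein1981,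
LiebSeiringerSolovejYngvason2005]

TWO-LAYER PLAN. Foreseen glued splits (k ≤ 3, depth 1), filed only after a crux moves:
ParticleTensorisation ⇐ LocalBlockAT (AT for observables of O(1)
particles at scale ξ: Dobrushin regime, the JastrowDobrushinRung mechanism, row sum of the ξ-healed
pair factor 4πρaξ² = 1/2) →
CollectiveBlockAT (AT for the collective linear statistics ρ_k, |k| ≤ 1/ξ: Var/ΣE Var_i = S(k) ≤ 1,
and for the positive-definite
quadratic tail via the Bauerschmidt–Bodineau covariance decomposition) → block-factorisation glue à
la CaputoMenzTetali2016.
SquareSummableInfluence ⇐ PairInfluenceReduction (I ≤ ρ∫(1 − f_eff)² + three-body remainder) →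
DressedPairTail (1 − f_eff ∈ L²(ℝ³)
uniformly in N: the Reatto–Chester r⁻² law for the true ground state) → glue. GroundStateRigidity ⇐
finite-v uniqueness (Perron–Frobenius,
provable) → hard-core component energetics. A TORUS TWIN of the line (translation-invariant
witnesses; output the PeriodicBEC body
stmt-8997 + BoundaryTransferWeak stmt-0827) exists but is deliberately not filed: the mode-free
Dirichlet frame needs neither.

KILL CRITERIA. ¬ParticleTensorisation for some admissible v at arbitrarily small ρ (no C works: a
heat-bath mode whose relaxation time grows with L for
every near-minimiser family) closes the route — `close --reason refuted:ParticleTensorisation` — and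
the slow mode is handed to the
landscape routes as a structural fact about |Ψ₀|². ¬SquareSummableInfluence (I ≥ const uniformly:
undressed tail) forces ONE pivot:
dressed predictors (let g_i see x_i through a fixed pair factor f(y − x_i), "dressed tensorisation",
restating A1/A2 together as new
items); if that is refuted too, close. ¬GroundStateRigidity by hard-core degeneracy ⇒ restate every
item for locally bounded v (new items;
the hard-core class then needs another route). A refutation of JastrowDobrushinRung or
IdealGasTensorisation on a TYPING corner
(not on the mathematics) ⇒ repaired items A1R/A2R with the corner closed, same glue. BEC or the
PeriodicBEC body (stmt-8997) +
BoundaryTransferWeak (stmt-0827) proved elsewhere moots the route.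

NOT DECOMPOSED YET. Constants (C, ε = 1/(4C), c = 3/4 → 3/8) and the measure-theoretic lemmas of
TensorisedIncrement (vecCons as a measure-preserving
equivalence, lintegral/Bochner Cauchy–Schwarz, maxOccupation ≤ N) — provers attach them with
--supports. GroundStateEnergyFinite
(E₀ < ⊤ eventually, needed inside the proofs of A2 and rigidity, never as a hypothesis of the glue).
The torus twin (above). The d = 1
autopsy (Tonks: A2 fails there — each particle's influence on ∏_j|sin π(y − x_j)/L| is O(1) at every
distance, I_N ~ N —; A1 in d = 1 is
left open: number rigidity is an infinite-volume notion and the CUE one-point conditional laws are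
spread over all gaps) stays a
refuter's consistency exercise, not an item. Entropy/MLSI versions and the grand-canonical
birth–death variant (Bertini2002 setting) are
not filed.

CHEAPEST FALSIFIER. (i) Done by hand (passes, gen 1 and re-checked): the card's toy — the Gaussian
collective measure ∝ exp(−(1/2V)Σ_(|k|<1/ξ) ũ(k)|ρ_k|²)∏dx_j
with ρũ(k) = 1/S(k) − 1 ~ 1/(kξ): the linearised heat-bath drift of ρ_k is −ρ_k/S(k), relaxation
RATE ≥ 1 per unit resampling time for
every k (hyperuniform modes relax faster), and the one-particle landscape has Var W ~ √(ρa³) ≪ 1, so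
C_AT(toy) = 1: no linear slow mode.
(ii) Cheapest real kill, not runnable in this seat: VMC with the LHY-healed Jastrow state at ρa³ =
10⁻³, N = 64…512 — estimate I_N
(resample one particle by heat-bath Metropolis, record the squared relative change of ∏_j f(y −
x_j)) and the integrated
autocorrelation time of Σ_j u_eff(y − x_j) under heat-bath sweeps; a linear drift in L of either
number kills A2 resp. A1.
(iii) Typing kills a refuter should run first: the corners N = 0, 1, f ≡ 1, E₀ = ⊤, m = ⊤ of every
item (all checked true or vacuous
above; the SwapJensen-type sign exploit does not arise — no free real constant enters a conclusion
unguarded).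

NUMBERS. Healing length ξ = (8πρa)^(−1/2); Dobrushin row sum of the ξ-healed pair factor ρ∫(1 − f²)
≈ 4πρaξ² = 1/2 (ρ-independent); of the r⁻²
tail out to L: ~L/ξ (divergent — why A1 is not Dobrushin). Heuristic influence sum I ≈ ρ(4π/3)a³ +
4πρa²ξ + 4πρb²/ξ (b = c/(2π²ρ), c = √(16πρa)), term by term
(4π/3)ρa³ + (4π/√(8π))√(ρa³) + (16√(8π)/π²)√(ρa³) ≈ (2.5 + 8.1)√(ρa³) ≈ 10.6√(ρa³) (ERRATUM rev 3,
refuter-rreview-0815T19-18: the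
'≈ 5√(ρa³)' of A2's gloss and of rev ≤ 2 dropped the factor 16√(8π)/π² of its own tail term; still
o(1), nothing in the items changes):
0.11 at ρa³ = 10⁻⁴, 0.011 at ρa³ = 10⁻⁶; the assembly needs I ≤ 1/(4C_AT), i.e. C_AT ≲ 2.3 resp. 23
(not 5 resp. 50).
Consistency floor: Bogoliubov depletion (8/(3√π))√(ρa³) ≈ 1.50√(ρa³) ≤ C_AT·I forces only C_AT ≥
0.14 (and C_AT ≥ 1 always, f of one
coordinate). d = 1 Tonks: λ_max ≈ 1.54√N (OneDimensionalHardCore) ⇒ C_AT·I_N ≥ 1 − O(N^(−1/2))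
there, realised by I_N ~ N.
JastrowDobrushinRung: α ≤ 1/5 ⇒ r ≤ 1/2 ⇒ C = 2. Kinetic-gap comparison: our final slack δ is chosen
AFTER N (δ → 0 at fixed N, L),
so the energy-window ceiling c ≤ 1/(M+1) for δ > 4π²M²N/L² (KineticGapLengthScalesNarrow (3)) never
applies; our c = 3/8.
Items at open: 12 (3 cruxes, 8 support, 1 assembly).

DEFINITION REQUESTS. None. Conditional variances / expectations are avoided by the
inf-over-predictors form (g_i independent of x_i via Function.update) and
the division-free weighting by Θ; everything is stated over
Literature.MathematicalPhysics.QuantumManyBody.BoseGas.(TrialState, energy,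
groundStateEnergy, boxN, maxOccupation, occupation, sideLength, IsRepulsiveFiniteRange, Space) and
the root abbrev BoseEinsteinCondensation
(lean search --decl: all present); Sketch.lean rc 0. Bib: Mayers2001 entry prepared (mayers.bib) for
`ledger bib add`.

Novelty: Searches (2026-08-15, this seat): `lit search --source arxiv "spectral gap Glauber dynamics Gibbs
point process continuum"` (2: arXiv:2601.18748
Kuchukova–Vempala–Zhang 2026, arXiv:2606.28009 Göbel–Jenssen–Michelen et al. 2026 — engine side);
`lit search --source arxiv` ×2 ("Bose-Einstein
condensation ground state Efron-Stein tensorization particles", "condensate depletion spectral gap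
Markov chain ground state measure bosons": 0
rows each); `lit search --source crossref "Jastrow wave function Bose-Einstein condensation Reatto
cluster expansion one-particle density matrix"`
(10: Reatto1969, Mayers2001 doi:10.1103/physrevb.64.224521, Mayers 2008
doi:10.1103/physreva.78.033618); `lit galaxy search --star all` ×3
("approximate tensorization": 9 rows — Capel–Bardet–Rouzé quantum AT slides, localization-schemes
notes, Efthymiou–Hayes–Štefankovič–Vigoda,
HDX concentration, none physical; "Gibbs sampler spectral gap": 0; "condensate fraction many-body
wave function conditional": 0);
`lit frontier AtomisticToContinuum --since 2022` (30 rows; nearest arXiv:2510.20493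
ChongLiangNam2026 and arXiv:2603.20776 Junge2026 —
kinetic/Neumann localisation, energy-window class); `lit bridges AtomisticToContinuum --cross any`
(nothing joining samplers to BEC);
local searchd timed out once, OpenAlex 429; plus the gen-1 / card-audit searches recorded on the
card (crossref ×7, galaxy ×3, 5 audit seats).
Nearest prior art found: Mayers2001 (condensate fraction as the mean squared overlap of the CONDI  [refs: 10.1103/physrevb.64.224521, 10.1103/physreva.78.033618, 2601.18748, 2606.28009, 2510.20493, 2603.20776, doi:10.1103/physrevb.64.224521, doi:10.1103/physreva.78.033618, Reatto1969, Mayers2001, ChongLiangNam2026, Junge2026, PenroseOnsager1956, GloriaOtto2011, GloriaNeukammOtto2014, Bertini2002, Wu2004, Wu2006, HelmuthPerkinsPetti2022]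

Barriers (technique_class: tensorisation, heat-bath-gap, ground-state-measure): - technique_class: tensorisation, heat-bath-gap, ground-state-measure
- Literature.Barriers.AtomisticToContinuum.PitaevskiiStringariOneDimension: RESPECTED, the line is
not dimension-blind: for the d = 1 Tonks gas λ_max ≈ 1.54√N, so by the route's own inequality
C_AT·I_N ≥ 1 − O(N^(−1/2)); concretely A2 FAILS in d = 1 (each particle's influence on the insertion
amplitude ∏_j|sin π(y−x_j)/L| is O(1) at every distance, I_N ~ N), while in d = 3 A2 rests on
square-integrability of the dressed r⁻² influence — an INFRARED use of d = 3 (summability of one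
squared influence over the phonon range), which is what the entry says an evasion must use.
- Literature.Barriers.AtomisticToContinuum.PitaevskiiStringariOneDimensionNarrow: same evasion
against the narrowed wording — no f-sum rule or compressibility input is used anywhere; the
d-dependence enters through the L²(ℝ^d)-summability of one dressed influence function (fails in d =
1, holds in d = 3), i.e. in the last, infrared step, as the narrowing demands.
- Literature.Barriers.AtomisticToContinuum.OneDimensionalHardCore: consistent and used as the d = 1
autopsy (Numbers); it constrains nothing in d = 3 because the mechanism is not interaction- or
dimension-generic (A2 is false for the impenetrable 1D gas).
- Literature.Barriers.AtomisticToContinuum.KineticGapLengthScales: EVADED — the only gap in the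
route is that of the fictitious heat-bath sampler on |Θ|², which relocates a particle across the
whole box in one move and is REQUIRED

History (route lifecycle, newest last):
- 2026-08-16T08:44:25Z · rev 4: restated Assembly (stmt-AtomisticToContinuum-14375) — route-repair (ground-failed, gen 1): restated Assembly (stmt-AtomisticToContinuum-14375, ground.trivial 'intros; aesop') — the rev-3 Assembly listed the glue su (planner-rground-AtomisticToContinuum-BECHeatBat-4fe071d7-0)

sub-problem: BoseEinsteinCondensation · status: open · opened planner-plancard-AtomisticToContinuum-BoseEin-0cdec678-g2-0 2026-08-15T19:07:51Z · rev 6 · ledger route-AtomisticToContinuum-BECHeatBathGap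
GENERATED by the gate from the ledger (D-0016/17). Provers cite these decls: `theorem foo : Summit.AtomisticToContinuum.BoseEinsteinCondensation.Theses.BECHeatBathGap.<Decl> := …` in Summits/AtomisticToContinuum/BoseEinsteinCondensation/Theorems/<Name>.lean.
-/

namespace Summit.AtomisticToContinuum.BoseEinsteinCondensation.Theses.BECHeatBathGap

open scoped BigOperators Topology Manifold Classical MeasureTheory ProbabilityTheory Matrix InnerProductSpace ComplexConjugate ContinuousMap
open Filter Set Function TopologicalSpace MeasureTheory

attribute [summit_statement] _root_.BoseEinsteinCondensation

/-- item stmt-AtomisticToContinuum-14367 · crux · rank 2 · open · by planner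
why it might fail: Uncharted: C uniform in L though the one-particle TV influence is ℓ¹-divergent (r⁻² phonon tail, Dobrushin row sums ~L/ξ): Wu/Dobrushin fail, Holley–Stroock useless (extensive log-density errors), Bauerschmidt–Bodineau needs Gibbs structure; one slow nonlinear collective mode kills it.
sources: Bertini2002, Wu2006, Wu2004, BauerschmidtBodineau2019, CaputoMenzTetali2016, KondratievKunaOhlerich2013
[crux] (card A1, Dirichlet, division-free) for every repulsive finite-range v there are ρ₀ > 0 and C
such that for 0 < ρ < ρ₀ and all large N, at EVERY slack δ > 0 SOME δ-near-minimiser Θ of the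
Dirichlet N-body energy in the box of side ((N+1)/ρ)^(1/3) satisfies approximate tensorisation of
variance over particle labels with constant C: for all bounded measurable F : Λ^N → ℂ and bounded
measurable predictors g_i not depending on x_i, min_c ∫ |F − cΘ|² ≤ C Σ_i ∫ |F − g_i Θ|² (for Θ > 0
a.e. this is Var_Θ²(f) ≤ C Σ_i E Var(f | x_j, j ≠ i), f = F/Θ: heat-bath spectral gap ≥ 1/C);
existential in Θ because near-minimisers at fixed δ may carry locally dominant microscopic bumps
that trap the sampler. [difficulty: open-problem] -/
@[route_item "route-AtomisticToContinuum-BECHeatBathGap", crux]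
def ParticleTensorisation : Prop :=
  ∀ v : ℝ → ENNReal, Literature.MathematicalPhysics.QuantumManyBody.BoseGas.IsRepulsiveFiniteRange v → ∃ ρ₀ : ℝ, 0 < ρ₀ ∧ ∃ C : ℝ, 0 < C ∧ ∀ ρ : ℝ, 0 < ρ → ρ < ρ₀ → ∀ᶠ N : ℕ in Filter.atTop, ∀ δ : ENNReal, 0 < δ → ∃ Θ : Literature.MathematicalPhysics.QuantumManyBody.BoseGas.TrialState N (Literature.MathematicalPhysics.QuantumManyBody.BoseGas.sideLength ρ (N + 1)), Literature.MathematicalPhysics.QuantumManyBody.BoseGas.energy v Θ ≤ Literature.MathematicalPhysics.QuantumManyBody.BoseGas.groundStateEnergy v N (Literature.MathematicalPhysics.QuantumManyBody.BoseGas.sideLength ρ (N + 1)) + δ ∧ ∀ (F : (Fin N → EuclideanSpace ℝ (Fin 3)) → ℂ) (g : Fin N → (Fin N → EuclideanSpace ℝ (Fin 3)) → ℂ), Measurable F → (∀ i, Measurable (g i)) → (∃ M : ℝ, ∀ X, ‖F X‖ ≤ M ∧ ∀ i, ‖g i X‖ ≤ M) → (∀ i X x, g i (Function.update X i x) = g i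 X) → ∃ c : ℂ, (∫⁻ X in Literature.MathematicalPhysics.QuantumManyBody.BoseGas.boxN N (Literature.MathematicalPhysics.QuantumManyBody.BoseGas.sideLength ρ (N + 1)), (‖F X - c * Θ.ψ X‖₊ : ENNReal) ^ 2) ≤ ENNReal.ofReal C * ∑ i : Fin N, ∫⁻ X in Literature.MathematicalPhysics.QuantumManyBody.BoseGas.boxN N (Literature.MathematicalPhysics.QuantumManyBody.BoseGas.sideLength ρ (N + 1)), (‖F X - g i X * Θ.ψ X‖₊ : ENNReal) ^ 2

/-- item stmt-AtomisticToContinuum-14368 · crux · rank 3 · open · by planner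
why it might fail: Needs the DRESSED decay of the y–x_i correlation in Ψ_(N+1)/Θ_N: with the undressed a/r tail out to L the sum is ~ρa²L → ∞; square-summability is the Reatto–Chester r⁻² law for the TRUE ground state, where the T = 0 infrared lives; universal-in-Θ typing presupposes fixed-N rigidity.
sources: ReattoChester1967, Reatto1969, Mayers2001, PenroseOnsager1956, LiebSeiringerSolovejYngvason2005, Literature.Barriers.AtomisticToContinuum.BogoliubovPerturbationInfraredNarrow
[crux] (card A2, Dirichlet) for every repulsive finite-range v and every ε > 0 there is ρ₀ > 0 such
that for 0 < ρ < ρ₀ and all large N there is δ₂ > 0 with: for EVERY δ₂-near-minimiser Θ of the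
N-body Dirichlet energy in the box of side ((N+1)/ρ)^(1/3) and every δ > 0, SOME δ-near-minimiser Ψ
of the (N+1)-body energy in the same box admits bounded measurable predictors g_i(y, X without x_i)
with Σ_i ∫ |Ψ(y,X) − g_i(y,X)Θ(X)|² ≤ ε — the total squared single-bath-particle resampling
influence on the insertion amplitude is o(1) (heuristically ≈ 5√(ρa³): core + a/r part up to ξ +
Reatto–Chester r⁻² tail, each square-integrable in d = 3; universal in Θ is safe because I is
L²-continuous in Θ, given rigidity at level N, δ₂ being chosen after N). [difficulty: XL] -/
@[route_item "route-AtomisticToContinuum-BECHeatBathGap", crux]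
def SquareSummableInfluence : Prop :=
  ∀ v : ℝ → ENNReal, Literature.MathematicalPhysics.QuantumManyBody.BoseGas.IsRepulsiveFiniteRange v → ∀ ε : ℝ, 0 < ε → ∃ ρ₀ : ℝ, 0 < ρ₀ ∧ ∀ ρ : ℝ, 0 < ρ → ρ < ρ₀ → ∀ᶠ N : ℕ in Filter.atTop, ∃ δ₂ : ENNReal, 0 < δ₂ ∧ ∀ Θ : Literature.MathematicalPhysics.QuantumManyBody.BoseGas.TrialState N (Literature.MathematicalPhysics.QuantumManyBody.BoseGas.sideLength ρ (N + 1)), Literature.MathematicalPhysics.QuantumManyBody.BoseGas.energy v Θ ≤ Literature.MathematicalPhysics.QuantumManyBody.BoseGas.groundStateEnergy v N (Literature.MathematicalPhysics.QuantumManyBody.BoseGas.sideLength ρ (N + 1)) + δ₂ → ∀ δ : ENNReal, 0 < δ → ∃ Ψ : Literature.MathematicalPhysics.QuantumManyBody.BoseGas.TrialState (N + 1) (Literature.MathematicalPhysics.QuantumManyBody.BoseGas.sideLength ρ (N + 1)), Literature.MathematicalPhysics.QuantumManyBody.BoseGas.energy v Ψ ≤ Literature.MathematicalPhysics.QuantumManyBody.BoseGas.groundStateEnergy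 v (N + 1) (Literature.MathematicalPhysics.QuantumManyBody.BoseGas.sideLength ρ (N + 1)) + δ ∧ ∃ g : Fin N → (Fin (N + 1) → EuclideanSpace ℝ (Fin 3)) → ℂ, (∀ i, Measurable (g i)) ∧ (∃ M : ℝ, ∀ i Z, ‖g i Z‖ ≤ M) ∧ (∀ i Z x, g i (Function.update Z (Fin.succ i) x) = g i Z) ∧ (∑ i : Fin N, ∫⁻ Z in Literature.MathematicalPhysics.QuantumManyBody.BoseGas.boxN (N + 1) (Literature.MathematicalPhysics.QuantumManyBody.BoseGas.sideLength ρ (N + 1)), (‖Ψ.ψ Z - g i Z * Θ.ψ (Matrix.vecTail Z)‖₊ : ENNReal) ^ 2) ≤ ENNReal.ofReal ε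

/-- item stmt-AtomisticToContinuum-9072 · crux · rank 4 · open · by planner
why it might fail: Hard cores (v = ⊤ on [0,R₀]) are admissible: the hard-sphere configuration space in Λ_L can be disconnected (caged/jammed components), so uniqueness needs every non-dilute component to sit a fixed-N gap above E₀ — a quantitative bound not in print.
sources: ReedSimonIV1978, Simon1982, BaryshnikovBubenikKahle2013, Kahle2012, LiebSeiringerSolovejYngvason2005
[crux] (shared verbatim with BECPalmLandscape stmt-AtomisticToContinuum-3298; the uniqueness input
of the descent) for every repulsive finite-range v there is ρ₀ > 0 such that for 0 < ρ < ρ₀ and all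
large N, for every η > 0 there is δ > 0 with: any two δ-near-minimisers Ψ, Φ of the Dirichlet energy
in the box of side (N/ρ)^{1/3} satisfy ∫|Ψ − cΦ|² ≤ η for some unit complex c (E₀ < ∞, compact
resolvent, unique positive ground state and spectral gap at fixed N). [difficulty: M] -/
@[route_item "route-AtomisticToContinuum-BECHeatBathGap", crux]
def GroundStateRigidity : Prop :=
  ∀ v : ℝ → ENNReal, Literature.MathematicalPhysics.QuantumManyBody.BoseGas.IsRepulsiveFiniteRange v → ∃ ρ₀ : ℝ, 0 < ρ₀ ∧ ∀ ρ : ℝ, 0 < ρ → ρ < ρ₀ → ∀ᶠ N : ℕ in Filter.atTop, ∀ η : ℝ, 0 < η → ∃ δ : ENNReal, 0 < δ ∧ ∀ Ψ Φ : Literature.MathematicalPhysics.QuantumManyBody.BoseGas.TrialState N (Literature.MathematicalPhysics.QuantumManyBody.BoseGas.sideLength ρ N), Literature.MathematicalPhysics.QuantumManyBody.BoseGas.energy v Ψ ≤ Literature.MathematicalPhysics.QuantumManyBody.BoseGas.groundStateEnergy v N (Literature.MathematicalPhysics.QuantumManyBody.BoseGas.sideLength ρ N) + δ → Literature.MathematicalPhysics.QuantumManyBody.BoseGas.energy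 v Φ ≤ Literature.MathematicalPhysics.QuantumManyBody.BoseGas.groundStateEnergy v N (Literature.MathematicalPhysics.QuantumManyBody.BoseGas.sideLength ρ N) + δ → ∃ c : ℂ, ‖c‖ = 1 ∧ ∫⁻ X, (‖Ψ.ψ X - c * Φ.ψ X‖₊ : ENNReal) ^ 2 ≤ ENNReal.ofReal η

/-- item stmt-AtomisticToContinuum-12061 · support · rank 9 · closed · proved by Summit.AtomisticToContinuum.BoseEinsteinCondensation.Theorems.DirichletRemovalBound_proof (prover) · by planner
sources: PenroseOnsager1956, LiebSeiringerSolovejYngvason2005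
[support] mode-free removal bound in ANY box (operator inequality γ_Φ ≥ (N+1)|g⟩⟨g|, g(y) = ∫ conj
Θ(X) Φ(y,X) dX for every normalised N-body Θ): (N+1)∫|g(y)|²dy ≤ maxOccupation (N+1) Φ for Dirichlet
trial states Φ (N+1 bodies) and Θ (N bodies); proof: if g ≠ 0 test maxOccupation with φ = g/‖g‖ and
apply Cauchy–Schwarz against Θ in the remaining variables (N = 0: equality 1 ≤ 1; L ≤ 0: empty
types). The transfer-free criterion for the Dirichlet rerun of the line (fallback if
BoundaryTransferWeak dies); serves the insertion/swap family of cards. [difficulty: M] -/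
@[route_item "route-AtomisticToContinuum-BECHeatBathGap", crux]
def DirichletRemovalBound : Prop :=
  ∀ (N : ℕ) (L : ℝ) (Φ : Literature.MathematicalPhysics.QuantumManyBody.BoseGas.TrialState (N + 1) L) (Θ : Literature.MathematicalPhysics.QuantumManyBody.BoseGas.TrialState N L), ((N : ENNReal) + 1) * ∫⁻ y, (‖∫ X, conj (Θ.ψ X) * Φ.ψ (Matrix.vecCons y X)‖₊ : ENNReal) ^ 2 ≤ Literature.MathematicalPhysics.QuantumManyBody.BoseGas.maxOccupation (N + 1) Φ.ψ

/-- item stmt-AtomisticToContinuum-14369 · support · rank 9 · open · by planner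
sources: PenroseOnsager1956, LiebSeiringerSolovejYngvason2005
[support] (intermediate node: the route's λ_max statement before rigidity) for every repulsive
finite-range v there is ρ₀ > 0 such that for 0 < ρ < ρ₀ there is c > 0 with: for all large N and
every δ > 0 SOME δ-near-minimiser Ψ of the (N+1)-body Dirichlet energy in the box of side
((N+1)/ρ)^(1/3) has λ_max(γ_Ψ) = maxOccupation ≥ c(N+1). It is the conclusion of TensorisedIncrement
(c = 3/4) and the first hypothesis of WitnessToBEC; filed before both so that the rendered file has
no forward reference. [difficulty: open-problem] -/
@[route_item "route-AtomisticToContinuum-BECHeatBathGap", crux]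
def SomeNearMinimiserCondenses : Prop :=
  ∀ v : ℝ → ENNReal, Literature.MathematicalPhysics.QuantumManyBody.BoseGas.IsRepulsiveFiniteRange v → ∃ ρ₀ : ℝ, 0 < ρ₀ ∧ ∀ ρ : ℝ, 0 < ρ → ρ < ρ₀ → ∃ c : ℝ, 0 < c ∧ ∀ᶠ N : ℕ in Filter.atTop, ∀ δ : ENNReal, 0 < δ → ∃ Ψ : Literature.MathematicalPhysics.QuantumManyBody.BoseGas.TrialState (N + 1) (Literature.MathematicalPhysics.QuantumManyBody.BoseGas.sideLength ρ (N + 1)), Literature.MathematicalPhysics.QuantumManyBody.BoseGas.energy v Ψ ≤ Literature.MathematicalPhysics.QuantumManyBody.BoseGas.groundStateEnergy v (N + 1) (Literature.MathematicalPhysics.QuantumManyBody.BoseGas.sideLength ρ (N + 1)) + δ ∧ ENNReal.ofReal (c * (N + 1)) ≤ Literature.MathematicalPhysics.QuantumManyBody.BoseGas.maxOccupation (N + 1) Ψ.ψ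

/-- item stmt-AtomisticToContinuum-14370 · support · rank 9 · closed · proved by Summit.AtomisticToContinuum.BoseEinsteinCondensation.Theorems.tensorisedIncrement_proof (prover) · by planner
sources: EfronStein1981, PenroseOnsager1956
[support] (card A3, the glue of the engine) ParticleTensorisation → SquareSummableInfluence →
DirichletRemovalBound → SomeNearMinimiserCondenses. Proof: with C from A1 take ε = 1/(4C) in A2; ρ₀
= min of the two thresholds, c = 3/4; for large N take δ₂ (A2), the witness Θ* of A1 at slack δ₂,
and for each δ the witness Ψ_δ of A2 applied to Θ*; apply A1 fibrewise in y to F_y = Ψ_δ(y,·),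
g_(y,i) = g_i(y,·) (bounded, measurable, update-invariant via Fin.cons_update), compare with the
projection onto the unit vector Θ*: ∫|F_y|² ≤ |m(y)|² + C Σ_i ∫|F_y − g_(y,i)Θ*|² (no truncated
subtraction), integrate over y (Tonelli; vecCons is a measure-preserving equivalence Λ × Λ^N ≃
Λ^(N+1)): 1 ≤ ∫|m|² + Cε = ∫|m|² + 1/4; DirichletRemovalBound then gives maxOccupation (N+1) Ψ_δ ≥
(N+1)∫|m|² ≥ (3/4)(N+1). Lean-heavy (MeasurableEquiv for vecCons, lintegral ↔ Bochner,
Cauchy–Schwarz), mathematically routine. [difficulty: L] -/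
@[route_item "route-AtomisticToContinuum-BECHeatBathGap", crux]
def TensorisedIncrement : Prop :=
  ParticleTensorisation → SquareSummableInfluence → DirichletRemovalBound → SomeNearMinimiserCondenses

/-- item stmt-AtomisticToContinuum-14371 · support · rank 9 · closed · proved by Summit.AtomisticToContinuum.BoseEinsteinCondensation.Theorems.becHeatBathGap_nearMinimiserStability_proof (prover) · by planner
sources: LiebSeiringerSolovejYngvason2005
[support] (verbatim the mooted shared item stmt-AtomisticToContinuum-3984) GroundStateRigidity → for
every v, small ρ and all large N: if for every δ > 0 SOME δ-near-minimiser has maxOccupation ≥ m,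
then for some δ > 0 EVERY δ-near-minimiser has maxOccupation ≥ m/2. Proof from rigidity with η ~ (1
− 1/√2)² m/N and OccupationStability taken sup over modes (maxOccupation^(1/2) is √N-Lipschitz in L²
up to phase); m ≤ N is forced by the hypothesis (maxOccupation ≤ N by Cauchy–Schwarz), m = ⊤ and
empty TrialState make it vacuous. [difficulty: provable-now] -/
@[route_item "route-AtomisticToContinuum-BECHeatBathGap"]
def NearMinimiserStability : Prop :=
  GroundStateRigidity → (∀ v : ℝ → ENNReal, Literature.MathematicalPhysics.QuantumManyBody.BoseGas.IsRepulsiveFiniteRange v → ∃ ρ₀ : ℝ, 0 < ρ₀ ∧ ∀ ρ : ℝ, 0 < ρ → ρ < ρ₀ → ∀ᶠ N : ℕ in Filter.atTop, ∀ m : ENNReal, (∀ δ : ENNReal, 0 < δ → ∃ Ψ : Literature.MathematicalPhysics.QuantumManyBody.BoseGas.TrialState N (Literature.MathematicalPhysics.QuantumManyBody.BoseGas.sideLength ρ N), Literature.MathematicalPhysics.QuantumManyBody.BoseGas.energy v Ψ ≤ Literature.MathematicalPhysics.QuantumManyBody.BoseGas.groundStateEnergy v N (Literature.MathematicalPhysics.QuantumManyBody.BoseGas.sideLength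 ρ N) + δ ∧ m ≤ Literature.MathematicalPhysics.QuantumManyBody.BoseGas.maxOccupation N Ψ.ψ) → ∃ δ : ENNReal, 0 < δ ∧ ∀ Ψ : Literature.MathematicalPhysics.QuantumManyBody.BoseGas.TrialState N (Literature.MathematicalPhysics.QuantumManyBody.BoseGas.sideLength ρ N), Literature.MathematicalPhysics.QuantumManyBody.BoseGas.energy v Ψ ≤ Literature.MathematicalPhysics.QuantumManyBody.BoseGas.groundStateEnergy v N (Literature.MathematicalPhysics.QuantumManyBody.BoseGas.sideLength ρ N) + δ → m / 2 ≤ Literature.MathematicalPhysics.QuantumManyBody.BoseGas.maxOccupation N Ψ.ψ)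

/-- item stmt-AtomisticToContinuum-14372 · support · rank 9 · closed · proved by Summit.AtomisticToContinuum.BoseEinsteinCondensation.Theorems.witnessToBEC_proof (prover) · by planner
sources: LiebSeiringerSolovejYngvason2005, PenroseOnsager1956
[support] (frame; NEW w.r.t. gen 1: concludes the sub-problem Statement decl
`BoseEinsteinCondensation`, the root abbrev, by name) SomeNearMinimiserCondenses →
NearMinimiserStability → GroundStateRigidity → BoseEinsteinCondensation: for v repulsive
finite-range take ρ₀ = min of the thresholds; eventually in N instantiate stability at index N+1
with m = ofReal(c(N+1)) to get δ > 0 with maxOccupation ≥ m/2 for every δ-near-minimiser, then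
le_condensateNumber and the index shift ∀ᶠ N ↦ N+1 (Nat.cast_succ, eventually_atTop) give
HasGroundStateBEC v ρ with constant c/2. [difficulty: provable-now] -/
@[route_item "route-AtomisticToContinuum-BECHeatBathGap"]
def WitnessToBEC : Prop :=
  SomeNearMinimiserCondenses → NearMinimiserStability → GroundStateRigidity → BoseEinsteinCondensation

/-- item stmt-AtomisticToContinuum-14373 · support · rank 9 · closed · proved by Summit.AtomisticToContinuum.BoseEinsteinCondensation.Theorems.jastrowDobrushinRung_proof @ c5fb556101e2 (prover) · by planner
sources: Wu2006, DobrushinShlosman1985, HoudebertZass2022, Reatto1969, Bertini2002, EfronStein1981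
[support] (card A4, classical rung; a theorem-candidate that de-risks the engine and its
division-free typing) for 0 ≤ f ≤ 1 even measurable with 1 − f² integrable and 5N∫(1 − f²) ≤ L³ (L >
0), the Jastrow law ∝ ∏_(i<j) f(x_i − x_j)² dX on Λ_L^N satisfies approximate tensorisation over
particles with constant 2: min_c ∫|F − c|²P ≤ 2 Σ_i ∫|F − g_i|²P (heat-bath gap ≥ 1/2). Proof
sketch: the TV-Dobrushin influence of x_j on the conditional law of x_i is ≤ 2∫(1−f²)/((1−α)L³), α =
N∫(1−f²)/L³ ≤ 1/5 (Z ≥ L³(1−α) by ∏(1−ε_k) ≥ 1 − Σε_k), so row sums r ≤ 2α/(1−α) ≤ 1/2; the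
Gibbs-sampler Dirichlet form is Σ_i E Var_i and its gap is ≥ 1 − r under Dobrushin uniqueness
(Wu2006; DobrushinShlosman1985). By the route's inequality it re-proves BEC for Reatto's Jastrow
states without cluster expansions. N = 0, 1 and f ≡ 1 (Efron–Stein) are the trivial corners, all
true. [difficulty: M] -/
@[route_item "route-AtomisticToContinuum-BECHeatBathGap"]
def JastrowDobrushinRung : Prop :=
  ∀ (N : ℕ) (L : ℝ), 0 < L → ∀ f : EuclideanSpace ℝ (Fin 3) → ℝ, Measurable f → (∀ x, 0 ≤ f x ∧ f x ≤ 1) → (∀ x, f (-x) = f x) → MeasureTheory.Integrable (fun x => 1 - f x ^ 2) → 5 * (N : ℝ) * (∫ x, (1 - f x ^ 2)) ≤ L ^ 3 → ∀ (F : (Fin N → EuclideanSpace ℝ (Fin 3)) → ℂ) (g : Fin N → (Fin N → EuclideanSpace ℝ (Fin 3)) → ℂ), Measurable F → (∀ i, Measurable (g i)) → (∃ M : ℝ, ∀ X, ‖F X‖ ≤ M ∧ ∀ i, ‖g i X‖ ≤ M) → (∀ i X x, g i (Function.update X i x) = g i X) → ∃ c : ℂ, (∫⁻ X in Literature.MathematicalPhysics.QuantumManyBody.BoseGas.boxN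 N L, (‖F X - c‖₊ : ENNReal) ^ 2 * ENNReal.ofReal (∏ i : Fin N, ∏ j ∈ Finset.univ.filter (fun j => i < j), f (X i - X j) ^ 2)) ≤ 2 * ∑ i : Fin N, ∫⁻ X in Literature.MathematicalPhysics.QuantumManyBody.BoseGas.boxN N L, (‖F X - g i X‖₊ : ENNReal) ^ 2 * ENNReal.ofReal (∏ i : Fin N, ∏ j ∈ Finset.univ.filter (fun j => i < j), f (X i - X j) ^ 2)

/-- item stmt-AtomisticToContinuum-14374 · support · rank 9 · closed · proved by Summit.AtomisticToContinuum.BoseEinsteinCondensation.Theorems.idealGasTensorisation_proof @ cd34ae42e31f (prover) · by planner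
sources: EfronStein1981, LiebSeiringerSolovejYngvason2005
[support] (NEW ideal-gas rung = the body of ParticleTensorisation at v = 0, all densities: a typing
check of the existential-witness AT clause that a prover can settle now) there is C > 0 (C = 1
works) such that for every ρ > 0, all large N and every δ > 0 some δ-near-minimiser Θ of the FREE
N-body Dirichlet energy in the box of side ((N+1)/ρ)^(1/3) satisfies the AT clause of A1 with
constant C. Proof: Θ = φ^⊗N with φ a C¹ one-body state supported in the open box and ∫|∇φ|² ≤ e₁ +
δ/N, e₁ the one-body infimum; E₀(N) ≥ N·e₁ by applying the one-body Rayleigh bound slice-wise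
(homogeneity + Fubini; the value 3π²/L² is not needed), so Θ is a δ-near-minimiser; AT with C = 1 is
Efron–Stein for the product law |φ|^(2⊗N) in the division-free form (on Θ = 0 both sides carry
∫|F|², N ≥ 1). [difficulty: M] -/
@[route_item "route-AtomisticToContinuum-BECHeatBathGap"]
def IdealGasTensorisation : Prop :=
  ∃ C : ℝ, 0 < C ∧ ∀ ρ : ℝ, 0 < ρ → ∀ᶠ N : ℕ in Filter.atTop, ∀ δ : ENNReal, 0 < δ → ∃ Θ : Literature.MathematicalPhysics.QuantumManyBody.BoseGas.TrialState N (Literature.MathematicalPhysics.QuantumManyBody.BoseGas.sideLength ρ (N + 1)), Literature.MathematicalPhysics.QuantumManyBody.BoseGas.energy (fun _ => 0) Θ ≤ Literature.MathematicalPhysics.QuantumManyBody.BoseGas.groundStateEnergy (fun _ => 0) N (Literature.MathematicalPhysics.QuantumManyBody.BoseGas.sideLength ρ (N + 1)) + δ ∧ ∀ (F : (Fin N → EuclideanSpace ℝ (Fin 3)) → ℂ) (g : Fin N → (Fin N → EuclideanSpace ℝ (Fin 3)) → ℂ), Measurable F → (∀ i, Measurable (g i)) → (∃ M : ℝ, ∀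 X, ‖F X‖ ≤ M ∧ ∀ i, ‖g i X‖ ≤ M) → (∀ i X x, g i (Function.update X i x) = g i X) → ∃ c : ℂ, (∫⁻ X in Literature.MathematicalPhysics.QuantumManyBody.BoseGas.boxN N (Literature.MathematicalPhysics.QuantumManyBody.BoseGas.sideLength ρ (N + 1)), (‖F X - c * Θ.ψ X‖₊ : ENNReal) ^ 2) ≤ ENNReal.ofReal C * ∑ i : Fin N, ∫⁻ X in Literature.MathematicalPhysics.QuantumManyBody.BoseGas.boxN N (Literature.MathematicalPhysics.QuantumManyBody.BoseGas.sideLength ρ (N + 1)), (‖F X - g i X * Θ.ψ X‖₊ : ENNReal) ^ 2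

/-- item stmt-AtomisticToContinuum-9074 · support · rank 9 · closed · proved by Summit.AtomisticToContinuum.BoseEinsteinCondensation.Theorems.occupationStability_proof @ 4a4e6659c153 (prover) · by planner
sources: LiebSeiringerSolovejYngvason2005
[support] (shared verbatim with BECPalmLandscape stmt-AtomisticToContinuum-3300) for a normalised
measurable mode u, trial states Ψ, Φ ∈ TrialState (n+1) L and |c| = 1: occ(u,Ψ)^{1/2} ≤
occ(u,Φ)^{1/2} + (n+1)^{1/2}·‖Ψ − cΦ‖₂ (Minkowski in L²(dY); occ(cΦ) = occ(Φ)). [difficulty: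
provable-now] -/
@[route_item "route-AtomisticToContinuum-BECHeatBathGap"]
def OccupationStability : Prop :=
  ∀ (n : ℕ) (L : ℝ) (u : Literature.MathematicalPhysics.QuantumManyBody.BoseGas.Space → ℂ), MeasureTheory.AEStronglyMeasurable u MeasureTheory.volume → ∫⁻ x, (‖u x‖₊ : ENNReal) ^ 2 = 1 → ∀ (Ψ Φ : Literature.MathematicalPhysics.QuantumManyBody.BoseGas.TrialState (n + 1) L) (c : ℂ), ‖c‖ = 1 → Literature.MathematicalPhysics.QuantumManyBody.BoseGas.occupation (n + 1) u Ψ.ψ ^ (1 / 2 : ℝ) ≤ Literature.MathematicalPhysics.QuantumManyBody.BoseGas.occupation (n + 1) u Φ.ψ ^ (1 / 2 : ℝ) + ((n + 1 : ℕ) : ENNReal) ^ (1 / 2 : ℝ) * (∫⁻ X, (‖Ψ.ψ X - c * Φ.ψ X‖₊ : ENNReal) ^ 2) ^ (1 / 2 : ℝ)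

/-- `OccupationStability` holds: proved by `Summit.AtomisticToContinuum.BoseEinsteinCondensation.Theorems.occupationStability_proof` @ 4a4e6659c153. -/
theorem OccupationStability_holds : OccupationStability := _root_.Summit.AtomisticToContinuum.BoseEinsteinCondensation.Theorems.occupationStability_proof

-- earlier Assembly (stmt-AtomisticToContinuum-14375, replaced 2026-08-16T08:44:25Z -> stmt-AtomisticToContinuum-15148): retired by None — ParticleTensorisation → SquareSummableInfluence → GroundStateRigidity → DirichletRemovalBound → TensorisedIncrement → NearMinimiserStability → WitnessToBEC → BoseEinsteinCondensation
/-- item stmt-AtomisticToContinuum-15148 · assembly · rank 1 · closed · proved by Summit.AtomisticToContinuum.BoseEinsteinCondensation.Theorems.becHeatBathGap_assembly_proof (prover) · by planner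
sources: PenroseOnsager1956, LiebSeiringerSolovejYngvason2005
[assembly] the frame statement "cruxes → Statement", support-free: ParticleTensorisation →
SquareSummableInfluence → GroundStateRigidity → BoseEinsteinCondensation — heat-bath approximate
tensorisation of |Θ_N|² over particle labels (A1) and square-summable one-particle influence on the
insertion amplitude (A2), together with fixed-N phase rigidity (shared crux), imply the audited
Dirichlet conjunct. It is the pure-logic consequence of the glue supports through the unchanged
deciding theorem: `fun h1 h2 h3 => closes h1 h2 h3 h4 h5 h6 h7` given h4 : DirichletRemovalBound
(proved), h5 : TensorisedIncrement, h6 : NearMinimiserStability, h7 : WitnessToBEC (planner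
Sketch.lean rc 0), so it closes when those supports close; `closes` keeps the full seven-item chain
and does not take Assembly as a hypothesis. History (route-repair, ground-failed, 2026-08-16): the
rev-3 form ParticleTensorisation → SquareSummableInfluence → GroundStateRigidity →
DirichletRemovalBound → TensorisedIncrement → NearMinimiserStability → WitnessToBEC →
BoseEinsteinCondensation listed the glue supports among its antecedents, was therefore verbatim the
type of `closes`, and was closed by `intros; aesop` (h21_ground -/
@[route_item "route-AtomisticToContinuum-BECHeatBathGap"]
def Assembly : Prop :=
  ParticleTensorisation → SquareSummableInfluence → GroundStateRigidity → _root_.BoseEinsteinCondensation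

/-! D-0027 §2.1 — DECIDING THEOREM (planner-authored via `route open/edit --closes-file`; by planner-rbadge-AtomisticToContinuum-BECHeatBat-4fe071d7-g3-0 2026-08-16T12:47:15Z):
its hypotheses are this route's items and its conclusion the sub-problem Statement (glue_lint), and it elaborates with this file. -/

@[closes "route-AtomisticToContinuum-BECHeatBathGap"] theorem closes (h1 : ParticleTensorisation) (h2 : SquareSummableInfluence)
    (h3 : GroundStateRigidity) (h4 : DirichletRemovalBound) (h5 : TensorisedIncrement) :
    BoseEinsteinCondensation := by
  /- (1) the frame `WitnessToBEC` (support stmt-AtomisticToContinuum-14372), PROVED here: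
     index shift `N ↦ N + 1` and `le_condensateNumber`. -/
  have h7 : WitnessToBEC := by
    intro hS hStab hR v hv
    obtain ⟨ρ₁, hρ₁, H1⟩ := hS v hv
    obtain ⟨ρ₂, hρ₂, H2⟩ := hStab hR v hv
    refine ⟨min ρ₁ ρ₂, lt_min hρ₁ hρ₂, fun ρ hρ hρlt => ?_⟩
    obtain ⟨c, hc, hN1⟩ := H1 ρ hρ (hρlt.trans_le (min_le_left _ _))
    obtain ⟨N₁, hN₁⟩ := Filter.eventually_atTop.1 hN1
    obtain ⟨N₂, hN₂⟩ := Filter.eventually_atTop.1 (H2 ρ hρ (hρlt.trans_le (min_le_right _ _)))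
    refine ⟨c / 2, by positivity, Filter.eventually_atTop.2 ⟨max (N₁ + 1) N₂, fun M hM => ?_⟩⟩
    obtain ⟨N, rfl⟩ : ∃ N, M = N + 1 := ⟨M - 1, by have := le_of_max_le_left hM; omega⟩
    obtain ⟨δ, hδ, hall⟩ := hN₂ (N + 1) (le_of_max_le_right hM) (ENNReal.ofReal (c * (N + 1 : ℕ)))
      (fun δ hδ => by
        obtain ⟨Ψ, hΨ, hocc⟩ := hN₁ N (by have := le_of_max_le_left hM; omega) δ hδ
        exact ⟨Ψ, hΨ, by push_cast; exact hocc⟩)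
    calc ENNReal.ofReal (c / 2 * ((N + 1 : ℕ) : ℝ)) = ENNReal.ofReal (c * (N + 1 : ℕ)) / 2 := by
          rw [show c / 2 * ((N + 1 : ℕ) : ℝ) = c * (N + 1 : ℕ) / 2 by ring,
            ENNReal.ofReal_div_of_pos two_pos, ENNReal.ofReal_ofNat]
      _ ≤ _ := Literature.MathematicalPhysics.QuantumManyBody.BoseGas.le_condensateNumber v hδ hall
  /- (2) `NearMinimiserStability` (support stmt-AtomisticToContinuum-14371), PROVED here from the
     rigidity hypothesis and the landed `OccupationStability_holds` (`occ^{1/2}` is `√N`-Lipschitz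
     up to phase): rigidity at scale `η` with `16 N η ≤ m` gives `3√m ≤ 4√(λ_max)`, so `m/2 ≤ λ_max`. -/
  have h6 : NearMinimiserStability := by
    intro hR v hv
    obtain ⟨ρ₀, hρ₀, H⟩ := hR v hv
    refine ⟨ρ₀, hρ₀, fun ρ hρ hρlt => ?_⟩
    filter_upwards [H ρ hρ hρlt, Filter.eventually_ge_atTop 1] with N hN hN1
    intro m hm
    obtain ⟨n, rfl⟩ : ∃ n, N = n + 1 := ⟨N - 1, by omega⟩
    rcases eq_or_ne m 0 with rfl | hm0
    · exact ⟨1, one_pos, fun Ψ _ => by simp⟩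
    have hsq : ∀ x : ENNReal, (x ^ (1 / 2 : ℝ)) ^ 2 = x := fun x => by
      rw [← ENNReal.rpow_two, ← ENNReal.rpow_mul]; norm_num
    have hsq' : ∀ x : ENNReal, (x ^ 2) ^ (1 / 2 : ℝ) = x := fun x => by
      rw [← ENNReal.rpow_two, ← ENNReal.rpow_mul]; norm_num
    -- a scale `η > 0` with `16 (n+1) η ≤ m`
    obtain ⟨η, hη, hηm⟩ : ∃ η : ℝ, 0 < η ∧ 16 * (((n + 1 : ℕ) : ENNReal) * ENNReal.ofReal η) ≤ m := by
      rcases eq_or_ne m ⊤ with hmtop | hmtop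
      · exact ⟨1, one_pos, by rw [hmtop]; exact le_top⟩
      have hmpos : 0 < m.toReal := ENNReal.toReal_pos hm0 hmtop
      refine ⟨m.toReal / (16 * (n + 1)), by positivity, le_of_eq ?_⟩
      rw [← ENNReal.ofReal_natCast, ← ENNReal.ofReal_mul (by positivity), ← ENNReal.ofReal_ofNat 16,
        ← ENNReal.ofReal_mul (by norm_num), ← ENNReal.ofReal_toReal hmtop]
      congr 1
      rw [ENNReal.toReal_ofReal hmpos.le]
      push_cast
      field_simp
    obtain ⟨δ, hδ, hrig⟩ := hN η hη
    refine ⟨δ, hδ, fun Ψ hΨ => ?_⟩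
    obtain ⟨Φ, hΦ, hmΦ⟩ := hm δ hδ
    obtain ⟨c, hc, hdist⟩ := hrig Φ Ψ hΦ hΨ
    set s := Literature.MathematicalPhysics.QuantumManyBody.BoseGas.maxOccupation (n + 1) Ψ.ψ with hs
    set t : ENNReal := (((n + 1 : ℕ) : ENNReal) * ENNReal.ofReal η) ^ (1 / 2 : ℝ) with ht
    -- every mode occupation of the witness `Φ` is `≤ (√s + t)²`, hence so is `m`
    have hmle : m ≤ (s ^ (1 / 2 : ℝ) + t) ^ 2 := hmΦ.trans (iSup₂_le fun u hu => by
      have h1 := OccupationStability_holds n _ u hu.1 hu.2 Φ Ψ c hc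
      have h2 := ENNReal.rpow_le_rpow (z := (1 / 2 : ℝ))
        (Literature.MathematicalPhysics.QuantumManyBody.BoseGas.occupation_le_maxOccupation Ψ.ψ
          hu.1 hu.2) (by norm_num)
      have h3 : ((n + 1 : ℕ) : ENNReal) ^ (1 / 2 : ℝ) *
          (∫⁻ X, (‖Φ.ψ X - c * Ψ.ψ X‖₊ : ENNReal) ^ 2) ^ (1 / 2 : ℝ) ≤ t := by
        rw [ht, ENNReal.mul_rpow_of_nonneg _ _ (by norm_num : (0:ℝ) ≤ 1 / 2)]
        gcongr
      rw [← hsq (Literature.MathematicalPhysics.QuantumManyBody.BoseGas.occupation (n + 1) u Φ.ψ)]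
      gcongr
      exact h1.trans (add_le_add h2 h3))
    have ht_top : t ≠ ⊤ := ENNReal.rpow_ne_top_of_nonneg (by norm_num)
      (ENNReal.mul_ne_top (ENNReal.natCast_ne_top _) ENNReal.ofReal_ne_top)
    -- `4 t ≤ √m ≤ √s + t`
    have h4t : 4 * t ≤ m ^ (1 / 2 : ℝ) := by
      have h16 : (16 * (((n + 1 : ℕ) : ENNReal) * ENNReal.ofReal η)) ^ (1 / 2 : ℝ) = 4 * t := by
        rw [ht, ENNReal.mul_rpow_of_nonneg 16 _ (by norm_num : (0:ℝ) ≤ 1 / 2)]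
        congr 1
        rw [show (16 : ENNReal) = 4 ^ 2 by norm_num, hsq']
      rw [← h16]
      exact ENNReal.rpow_le_rpow hηm (by norm_num)
    have hroot : m ^ (1 / 2 : ℝ) ≤ s ^ (1 / 2 : ℝ) + t := by
      rw [← hsq' (s ^ (1 / 2 : ℝ) + t)]
      exact ENNReal.rpow_le_rpow hmle (by norm_num)
    rcases eq_or_ne s ⊤ with hstop | hstop
    · rw [hstop]; exact le_top
    have hs2 : s ^ (1 / 2 : ℝ) ≠ ⊤ := ENNReal.rpow_ne_top_of_nonneg (by norm_num) hstop
    rcases eq_or_ne m ⊤ with hmtop | hmtop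
    · exfalso
      rw [hmtop, ENNReal.top_rpow_of_pos (by norm_num : (0:ℝ) < 1 / 2)] at hroot
      exact (ENNReal.add_ne_top.2 ⟨hs2, ht_top⟩) (top_le_iff.1 hroot)
    have hm2 : m ^ (1 / 2 : ℝ) ≠ ⊤ := ENNReal.rpow_ne_top_of_nonneg (by norm_num) hmtop
    -- `3 √m ≤ 4 √s`, squared: `9 m ≤ 16 s ≤ 9 (2 s)`
    have h34 : 3 * m ^ (1 / 2 : ℝ) ≤ 4 * s ^ (1 / 2 : ℝ) := by
      refine (ENNReal.add_le_add_iff_right hm2).1 ?_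
      calc 3 * m ^ (1 / 2 : ℝ) + m ^ (1 / 2 : ℝ) = 4 * m ^ (1 / 2 : ℝ) := by ring
        _ ≤ 4 * (s ^ (1 / 2 : ℝ) + t) := by gcongr
        _ = 4 * s ^ (1 / 2 : ℝ) + 4 * t := by ring
        _ ≤ 4 * s ^ (1 / 2 : ℝ) + m ^ (1 / 2 : ℝ) := by gcongr
    have h916 : 9 * m ≤ 9 * (2 * s) := by
      have h := pow_le_pow_left' h34 2
      rw [mul_pow, mul_pow, hsq, hsq] at h
      norm_num at h
      exact h.trans (by rw [← mul_assoc]; gcongr; norm_num)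
    exact ENNReal.div_le_of_le_mul (by
      rw [mul_comm]; exact (ENNReal.mul_le_mul_iff_right (by norm_num) (by norm_num)).1 h916)
  /- (3) assembly: `WitnessToBEC (TensorisedIncrement A1 A2 DRB) NearMinimiserStability Rigidity`. -/
  exact h7 (h5 h1 h2 h4) h6 h3

end Summit.AtomisticToContinuum.BoseEinsteinCondensation.Theses.BECHeatBathGap
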